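import Literature.Geometry.Lorentzian.KerrTimelikeSpan
import HarnessLib

/-!
# The surface gravity `κ(M, a)` of the Kerr event horizon

(family `gr`; namespace `Literature.Geometry.Lorentzian.Kerr`, companion of `Kerr.rPlus`, `Kerr.rMinus`,
`Kerr.IsSubextremal`, `Kerr.IsExtremal` in `KerrSchild.lean` and of `Kerr.horizonAngularVelocity`,
`Kerr.rPlus_sq_add_sq` in `KerrTimelikeSpan.lean`.)

The **surface gravity** of a stationary black hole is the function `κ` on the event horizon with
`∇^a(χ^b χ_b) = −2κ χ^a`, equivalently `χ^b ∇_b χ^a = κ χ^a`, for the Killing field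
`χ = ξ + Ω_H ψ` normal to the horizon (Wald 1984, §12.5, (12.5.1)–(12.5.2), (12.5.5); Dafermos–Rodnianski,
arXiv:0811.0354, §3.3 and §7: `∇_T T = κ T` on `𝓗⁺`, "the so-called surface gravity"); it is a
constant on the horizon. For the Kerr family `g_{M,a}`, `0 ≤ |a| ≤ M`, its value is
(Wald 1984, eq. (12.5.4) with charge `e = 0`)

  `κ = √(M² − a²) / (2M (M + √(M² − a²))) = √(M² − a²) / (2 M r₊)`,

and since `r₊² + a² = 2 M r₊` (`Δ(r₊) = 0`, `Kerr.rPlus_sq_add_sq`) and `r₊ − r₋ = 2√(M² − a²)`,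
equivalently `κ = √(M² − a²)/(r₊² + a²) = (r₊ − r₋)/(2(r₊² + a²)) = (r₊ − M)/(r₊² + a²)`
(Townsend, arXiv:gr-qc/9707012, §6, Question 2, prints the same number as
`√(M⁴ − J²)/(2M(M² + √(M⁴ − J²)))`, `J = Ma`).

We take `κ(M, a) := √(M² − a²)/(r₊² + a²)` as the definition (`Kerr.surfaceGravity`): a closed
formula in the parameters with no side condition, which vanishes exactly on the extremal family
among `0 < M`, `|a| ≤ M`.

## Contents (elementary real algebra only)

* `Kerr.surfaceGravity` and its rewritings `surfaceGravity_eq_rPlus_sub_rMinus_div`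
  (`(r₊ − r₋)/(2(r₊² + a²))`, unconditional), `surfaceGravity_eq_rPlus_sub_div`
  (`(r₊ − M)/(r₊² + a²)`, unconditional), `surfaceGravity_eq_div_two_mul_rPlus` (Wald's
  `√(M² − a²)/(2Mr₊)`, for `|a| ≤ M`), `surfaceGravity_eq_wald` (the printed (12.5.4));
* sign: `surfaceGravity_nonneg`; for `0 < M`: `surfaceGravity_eq_zero_iff : κ = 0 ↔ M ≤ |a|`,
  `surfaceGravity_pos_iff : 0 < κ ↔ IsSubextremal M a`; `IsExtremal.surfaceGravity_eq_zero`,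
  `IsSubextremal.surfaceGravity_pos` (the extremal horizon is the degenerate one, `κ = 0`);
* Schwarzschild: `surfaceGravity_zero_right : κ(M, 0) = 1/(4M)`, and `surfaceGravity_le : κ ≤ 1/(4M)`;
* comparison with the extremality parameter `√(1 − (a/M)²)` (from `M ≤ r₊ ≤ 2M`): for `0 < M`,
  `|a| ≤ M`, `√(M² − a²)/(4M²) ≤ κ ≤ √(M² − a²)/(2M²)`, i.e.
  `√(1 − (a/M)²)/4 ≤ M κ ≤ √(1 − (a/M)²)/2` (`mul_surfaceGravity_mem_Icc`);
* scaling (`κ` has dimension length⁻¹): `rPlus_mul_left`, `rMinus_mul_left`,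
  `surfaceGravity_mul_left : κ(cM, ca) = κ(M, a)/c` for `0 < c`.

## Junk values

For `|a| > M ≥ 0` the square root vanishes (`Real.sqrt` of a negative number is `0`), so `κ = 0`, as
on the extremal family (there is no horizon; nothing uses this value). For `M = a = 0` the
denominator vanishes and `κ = 0 / 0 = 0`. For `M < 0` the number is meaningless and no statement
below covers it.

## What is deliberately not here

The geometric identification — that `∇_K K = κ K` on `𝓗⁺ = {r = r₊}` with this `κ` for the null
generator `K = T + ω₊ Φ` (`Kerr.hawkingField`) of the Kerr–Schild metric `Kerr.metric` — is a
computation with the Levi-Civita connection of `KerrSchild.lean` and belongs with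
`KerrHawkingField.lean`; it is not needed by the requesting route (PhaseMixingCapture), which only
uses `κ` as the explicit function of `(M, a)` appearing in constants.

## References

* R. M. Wald, *General Relativity*, University of Chicago Press 1984, §12.5, eqs. (12.5.1)–(12.5.5),
  in particular (12.5.4) (key `Wald1984GR`).
* M. Dafermos, I. Rodnianski, *Lectures on black holes and linear waves*, arXiv:0811.0354 (Clay Math.
  Proc. 17, 2013), §3.3 and §7 (key `DafermosRodnianski2008`).
* P. K. Townsend, *Black holes*, lecture notes, arXiv:gr-qc/9707012, §3.6.1 and §6 Q.2.
-/

noncomputable section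

namespace Literature.Geometry.Lorentzian

namespace Kerr

/-! ### Horizon radii: complements to `KerrSchild.lean` -/

/-- `r₊ − r₋ = 2√(M² − a²)` (immediate from `r± = M ± √(M² − a²)`; Wald 1984, §12.3, the roots of
`Δ = r² − 2Mr + a²`). [cite: Wald1984GR, §12.3] -/
theorem rPlus_sub_rMinus (M a : ℝ) : rPlus M a - rMinus M a = 2 * √(M ^ 2 - a ^ 2) := by
  unfold rPlus rMinus
  ring

/-- `r₊ − M = √(M² − a²)` (Wald 1984, §12.3). [cite: Wald1984GR, §12.3] -/
theorem rPlus_sub_self (M a : ℝ) : rPlus M a - M = √(M ^ 2 - a ^ 2) := by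
  unfold rPlus
  ring

/-- `r₊ ≤ 2M` for `0 ≤ M` (since `√(M² − a²) ≤ √(M²) = M`; Wald 1984, §12.3). [cite: Wald1984GR, §12.3] -/
theorem rPlus_le_two_mul_self {M : ℝ} (hM : 0 ≤ M) (a : ℝ) : rPlus M a ≤ 2 * M := by
  have h1 : √(M ^ 2 - a ^ 2) ≤ √(M ^ 2) := Real.sqrt_le_sqrt (by nlinarith [sq_nonneg a])
  rw [Real.sqrt_sq hM] at h1
  unfold rPlus
  linarith

/-- `0 < r₊` for `0 < M` (Wald 1984, §12.3). [cite: Wald1984GR, §12.3] -/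
theorem rPlus_pos {M : ℝ} (hM : 0 < M) (a : ℝ) : 0 < rPlus M a := by
  unfold rPlus
  linarith [Real.sqrt_nonneg (M ^ 2 - a ^ 2)]

/-- Scaling of the outer horizon radius: `r₊(cM, ca) = c r₊(M, a)` for `0 ≤ c` (`r₊` is a length;
Wald 1984, §12.3). [cite: Wald1984GR, §12.3] -/
theorem rPlus_mul_left {c : ℝ} (hc : 0 ≤ c) (M a : ℝ) : rPlus (c * M) (c * a) = c * rPlus M a := by
  unfold rPlus
  rw [show (c * M) ^ 2 - (c * a) ^ 2 = c ^ 2 * (M ^ 2 - a ^ 2) by ring,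
    Real.sqrt_mul (sq_nonneg c), Real.sqrt_sq hc]
  ring

/-- Scaling of the inner horizon radius: `r₋(cM, ca) = c r₋(M, a)` for `0 ≤ c` (Wald 1984, §12.3).
[cite: Wald1984GR, §12.3] -/
theorem rMinus_mul_left {c : ℝ} (hc : 0 ≤ c) (M a : ℝ) :
    rMinus (c * M) (c * a) = c * rMinus M a := by
  unfold rMinus
  rw [show (c * M) ^ 2 - (c * a) ^ 2 = c ^ 2 * (M ^ 2 - a ^ 2) by ring,
    Real.sqrt_mul (sq_nonneg c), Real.sqrt_sq hc]
  ring

/-! ### The surface gravity -/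

/-- The **surface gravity** `κ(M, a) = √(M² − a²) / (r₊² + a²)` of the event horizon `{r = r₊}` of
the Kerr black hole `g_{M,a}`: the constant `κ` with `χ^b ∇_b χ^a = κ χ^a` on the horizon for the
null-generator Killing field `χ = ξ + Ω_H ψ` (Wald 1984, (12.5.2), (12.5.5)). Wald's (12.5.4) with
`e = 0` reads `κ = √(M² − a²)/(2M(M + √(M² − a²))) = √(M² − a²)/(2Mr₊)`, which is this number
because `r₊² + a² = 2Mr₊` (`surfaceGravity_eq_wald`); also `κ = (r₊ − r₋)/(2(r₊² + a²))`
(`surfaceGravity_eq_rPlus_sub_rMinus_div`). Junk values: `κ = 0` for `|a| > M` (the square root of a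
negative number is `0`) and for `M = a = 0` (`0/0 = 0`). [cite: Wald1984GR, §12.5 eq. (12.5.4)] -/
def surfaceGravity (M a : ℝ) : ℝ := √(M ^ 2 - a ^ 2) / (rPlus M a ^ 2 + a ^ 2)

/-- Unfolding of `Kerr.surfaceGravity` (Wald 1984, (12.5.4)). [cite: Wald1984GR, §12.5 eq. (12.5.4)] -/
theorem surfaceGravity_def (M a : ℝ) :
    surfaceGravity M a = √(M ^ 2 - a ^ 2) / (rPlus M a ^ 2 + a ^ 2) := rfl

/-- `κ ≥ 0` for all parameters (Wald 1984, §12.5). [cite: Wald1984GR, §12.5] -/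
theorem surfaceGravity_nonneg (M a : ℝ) : 0 ≤ surfaceGravity M a := by
  unfold surfaceGravity
  positivity

/-- `κ = (r₊ − r₋) / (2(r₊² + a²))`, for all real `M, a` (Wald 1984, §12.5 with §12.3).
[cite: Wald1984GR, §12.5 eq. (12.5.4)] -/
theorem surfaceGravity_eq_rPlus_sub_rMinus_div (M a : ℝ) :
    surfaceGravity M a = (rPlus M a - rMinus M a) / (2 * (rPlus M a ^ 2 + a ^ 2)) := by
  rw [rPlus_sub_rMinus, surfaceGravity, mul_div_mul_left _ _ (two_ne_zero' ℝ)]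

/-- `κ = (r₊ − M) / (r₊² + a²)`, for all real `M, a` (Wald 1984, §12.5 with §12.3).
[cite: Wald1984GR, §12.5 eq. (12.5.4)] -/
theorem surfaceGravity_eq_rPlus_sub_div (M a : ℝ) :
    surfaceGravity M a = (rPlus M a - M) / (rPlus M a ^ 2 + a ^ 2) := by
  rw [rPlus_sub_self, surfaceGravity]

/-- `κ = √(M² − a²) / (2 M r₊)` whenever `|a| ≤ M` (so that `r₊² + a² = 2Mr₊`): Wald's form of the
Kerr surface gravity (Wald 1984, (12.5.4), `e = 0`). [cite: Wald1984GR, §12.5 eq. (12.5.4)] -/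
theorem surfaceGravity_eq_div_two_mul_rPlus {M a : ℝ} (h : |a| ≤ M) :
    surfaceGravity M a = √(M ^ 2 - a ^ 2) / (2 * M * rPlus M a) := by
  rw [surfaceGravity, rPlus_sq_add_sq h]

/-- Wald 1984, eq. (12.5.4) with `e = 0`, as printed:
`κ = (M² − a²)^{1/2} / (2M [M + (M² − a²)^{1/2}])`, for `|a| ≤ M`. [cite: Wald1984GR, §12.5 eq. (12.5.4)] -/
theorem surfaceGravity_eq_wald {M a : ℝ} (h : |a| ≤ M) :
    surfaceGravity M a = √(M ^ 2 - a ^ 2) / (2 * M * (M + √(M ^ 2 - a ^ 2))) :=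
  surfaceGravity_eq_div_two_mul_rPlus h

/-- `κ = 0` as soon as `M² ≤ a²` (extremal or over-extreme parameters: the square root vanishes).
Wald 1984, §12.5. [cite: Wald1984GR, §12.5 eq. (12.5.4)] -/
theorem surfaceGravity_eq_zero_of_sq_le {M a : ℝ} (h : M ^ 2 ≤ a ^ 2) : surfaceGravity M a = 0 := by
  rw [surfaceGravity, Real.sqrt_eq_zero'.2 (sub_nonpos.2 h), zero_div]

/-- For `0 < M`: `κ(M, a) = 0 ↔ M ≤ |a|`, i.e. the surface gravity vanishes exactly on the extremal
family `|a| = M` (and on the horizonless junk range `|a| > M`). Wald 1984, §12.5, (12.5.4).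
[cite: Wald1984GR, §12.5 eq. (12.5.4)] -/
theorem surfaceGravity_eq_zero_iff {M : ℝ} (hM : 0 < M) (a : ℝ) :
    surfaceGravity M a = 0 ↔ M ≤ |a| := by
  have hD : 0 < rPlus M a ^ 2 + a ^ 2 := by
    have := rPlus_pos hM a
    positivity
  rw [surfaceGravity, div_eq_zero_iff, or_iff_left hD.ne', Real.sqrt_eq_zero', sub_nonpos,
    sq_le_sq, abs_of_pos hM]

/-- For `0 < M`: `0 < κ(M, a) ↔ |a| < M` (positive surface gravity = non-degenerate horizon =
subextremal Kerr). Wald 1984, §12.5; Dafermos–Rodnianski arXiv:0811.0354, §7 (`κ > 0` for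
non-extremal black holes). [cite: Wald1984GR, §12.5 eq. (12.5.4)] -/
theorem surfaceGravity_pos_iff {M : ℝ} (hM : 0 < M) (a : ℝ) :
    0 < surfaceGravity M a ↔ IsSubextremal M a := by
  rw [(surfaceGravity_nonneg M a).lt_iff_ne', Ne, surfaceGravity_eq_zero_iff hM, not_le,
    IsSubextremal]

/-- Subextremal Kerr black holes have positive surface gravity (Dafermos–Rodnianski
arXiv:0811.0354, §7; Wald 1984, (12.5.4)). [cite: DafermosRodnianski2008, §7] -/
theorem IsSubextremal.surfaceGravity_pos {M a : ℝ} (h : IsSubextremal M a) :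
    0 < surfaceGravity M a :=
  (surfaceGravity_pos_iff h.pos a).2 h

/-- Extremal Kerr black holes have vanishing surface gravity (degenerate horizon; Wald 1984,
(12.5.4)). [cite: Wald1984GR, §12.5 eq. (12.5.4)] -/
theorem IsExtremal.surfaceGravity_eq_zero {M a : ℝ} (h : IsExtremal M a) :
    surfaceGravity M a = 0 :=
  (surfaceGravity_eq_zero_iff h.2 a).2 h.1.ge

/-! ### Schwarzschild value and the upper bound `κ ≤ 1/(4M)` -/

/-- The Schwarzschild surface gravity: `κ(M, 0) = 1/(4M)` for `0 ≤ M` (Wald 1984, (12.5.4) with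
`a = e = 0`; for `M = 0` both sides are the junk value `0`). [cite: Wald1984GR, §12.5 eq. (12.5.4)] -/
theorem surfaceGravity_zero_right {M : ℝ} (hM : 0 ≤ M) : surfaceGravity M 0 = 1 / (4 * M) := by
  rw [surfaceGravity, rPlus_zero_right hM, show M ^ 2 - (0 : ℝ) ^ 2 = M ^ 2 by ring, Real.sqrt_sq hM]
  rcases hM.eq_or_lt with rfl | hM'
  · simp
  · field_simp
    ring

/-- `κ(M, a) ≤ 1/(4M)` for `0 < M`: the Schwarzschild member maximises the surface gravity at fixed
mass (`κ = s/(2M(M + s))`, `s = √(M² − a²) ≤ M`; Wald 1984, (12.5.4)). [cite: Wald1984GR, §12.5 eq. (12.5.4)] -/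
theorem surfaceGravity_le {M : ℝ} (hM : 0 < M) (a : ℝ) : surfaceGravity M a ≤ 1 / (4 * M) := by
  rcases le_or_gt |a| M with h | h
  · have hs0 : 0 ≤ √(M ^ 2 - a ^ 2) := Real.sqrt_nonneg _
    have hsM : √(M ^ 2 - a ^ 2) ≤ M := by
      calc √(M ^ 2 - a ^ 2) ≤ √(M ^ 2) := Real.sqrt_le_sqrt (by nlinarith [sq_nonneg a])
        _ = M := Real.sqrt_sq hM.le
    rw [surfaceGravity_eq_wald h, div_le_div_iff₀ (by positivity) (by positivity)]
    nlinarith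
  · rw [surfaceGravity_eq_zero_of_sq_le (by nlinarith [abs_nonneg a, sq_abs a])]
    positivity

/-! ### Comparison with the extremality parameter `√(1 − (a/M)²)` -/

/-- `M κ = √(M² − a²)/(2 r₊)` for `|a| ≤ M`, `0 < M` (from Wald's form `κ = √(M² − a²)/(2Mr₊)`).
[cite: Wald1984GR, §12.5 eq. (12.5.4)] -/
theorem mul_surfaceGravity_eq {M a : ℝ} (h : |a| ≤ M) (hM : 0 < M) :
    M * surfaceGravity M a = √(M ^ 2 - a ^ 2) / (2 * rPlus M a) := by
  have hr := rPlus_pos hM a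
  rw [surfaceGravity_eq_div_two_mul_rPlus h]
  field_simp

/-- Lower bound `√(M² − a²)/(4M²) ≤ κ` for `|a| ≤ M`, `0 < M` (from `r₊ ≤ 2M` in
`κ = √(M² − a²)/(2Mr₊)`, Wald 1984, (12.5.4)). [cite: Wald1984GR, §12.5 eq. (12.5.4)] -/
theorem sqrt_div_le_surfaceGravity {M a : ℝ} (h : |a| ≤ M) (hM : 0 < M) :
    √(M ^ 2 - a ^ 2) / (4 * M ^ 2) ≤ surfaceGravity M a := by
  have hr := rPlus_pos hM a
  have h2 := rPlus_le_two_mul_self hM.le a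
  rw [surfaceGravity_eq_div_two_mul_rPlus h]
  exact div_le_div_of_nonneg_left (Real.sqrt_nonneg _) (by positivity) (by nlinarith)

/-- Upper bound `κ ≤ √(M² − a²)/(2M²)` for `|a| ≤ M`, `0 < M` (from `M ≤ r₊` in
`κ = √(M² − a²)/(2Mr₊)`, Wald 1984, (12.5.4)). [cite: Wald1984GR, §12.5 eq. (12.5.4)] -/
theorem surfaceGravity_le_sqrt_div {M a : ℝ} (h : |a| ≤ M) (hM : 0 < M) :
    surfaceGravity M a ≤ √(M ^ 2 - a ^ 2) / (2 * M ^ 2) := by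
  -- `M ≤ r₊` is `M_le_rPlus` of `KerrSeparatedPotentialBounds.lean` (heavy import; re-derived inline)
  have h1 : M ≤ rPlus M a := by
    unfold rPlus
    linarith [Real.sqrt_nonneg (M ^ 2 - a ^ 2)]
  rw [surfaceGravity_eq_div_two_mul_rPlus h]
  exact div_le_div_of_nonneg_left (Real.sqrt_nonneg _) (by positivity) (by nlinarith)

/-- `√(1 − (a/M)²) = √(M² − a²)/M` for `0 < M`: the dimensionless extremality parameter.
[folklore] -/
theorem sqrt_one_sub_div_sq {M : ℝ} (hM : 0 < M) (a : ℝ) :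
    √(1 - (a / M) ^ 2) = √(M ^ 2 - a ^ 2) / M := by
  rw [show 1 - (a / M) ^ 2 = (M ^ 2 - a ^ 2) / M ^ 2 by field_simp, Real.sqrt_div' _ (sq_nonneg M),
    Real.sqrt_sq hM.le]

/-- Two-sided comparison of `M κ` with the extremality parameter: for `0 < M` and `|a| ≤ M`,
`√(1 − (a/M)²)/4 ≤ M κ(M, a) ≤ √(1 − (a/M)²)/2` (from `M ≤ r₊ ≤ 2M` in Wald's
`κ = √(M² − a²)/(2Mr₊)`, (12.5.4)); in particular `κ` and `√(1 − (a/M)²)/M` are comparable up to the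
absolute constants `1/4`, `1/2` uniformly on the subextremal family. [cite: Wald1984GR, §12.5 eq. (12.5.4)] -/
theorem mul_surfaceGravity_mem_Icc {M a : ℝ} (h : |a| ≤ M) (hM : 0 < M) :
    M * surfaceGravity M a ∈ Set.Icc (√(1 - (a / M) ^ 2) / 4) (√(1 - (a / M) ^ 2) / 2) := by
  rw [sqrt_one_sub_div_sq hM]
  constructor
  · have := mul_le_mul_of_nonneg_left (sqrt_div_le_surfaceGravity h hM) hM.le
    calc √(M ^ 2 - a ^ 2) / M / 4 = M * (√(M ^ 2 - a ^ 2) / (4 * M ^ 2)) := by field_simp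
      _ ≤ M * surfaceGravity M a := this
  · have := mul_le_mul_of_nonneg_left (surfaceGravity_le_sqrt_div h hM) hM.le
    calc M * surfaceGravity M a ≤ M * (√(M ^ 2 - a ^ 2) / (2 * M ^ 2)) := this
      _ = √(M ^ 2 - a ^ 2) / M / 2 := by field_simp

/-- Lower comparison `√(1 − (a/M)²)/4 ≤ M κ(M, a)` for `0 < M`, `|a| ≤ M` (Wald 1984, (12.5.4) and
`r₊ ≤ 2M`). [cite: Wald1984GR, §12.5 eq. (12.5.4)] -/
theorem sqrt_extremality_div_four_le {M a : ℝ} (h : |a| ≤ M) (hM : 0 < M) :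
    √(1 - (a / M) ^ 2) / 4 ≤ M * surfaceGravity M a :=
  (mul_surfaceGravity_mem_Icc h hM).1

/-- Upper comparison `M κ(M, a) ≤ √(1 − (a/M)²)/2` for `0 < M`, `|a| ≤ M` (Wald 1984, (12.5.4) and
`M ≤ r₊`). [cite: Wald1984GR, §12.5 eq. (12.5.4)] -/
theorem mul_surfaceGravity_le_sqrt_extremality_div_two {M a : ℝ} (h : |a| ≤ M) (hM : 0 < M) :
    M * surfaceGravity M a ≤ √(1 - (a / M) ^ 2) / 2 :=
  (mul_surfaceGravity_mem_Icc h hM).2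

/-! ### Scaling -/

/-- Scale covariance: `κ(cM, ca) = κ(M, a)/c` for `0 < c` (`κ` has dimension length⁻¹; Wald 1984,
(12.5.4) is homogeneous of degree `−1` in `(M, a)`). [cite: Wald1984GR, §12.5 eq. (12.5.4)] -/
theorem surfaceGravity_mul_left {c : ℝ} (hc : 0 < c) (M a : ℝ) :
    surfaceGravity (c * M) (c * a) = surfaceGravity M a / c := by
  rw [surfaceGravity, surfaceGravity, rPlus_mul_left hc.le,
    show (c * M) ^ 2 - (c * a) ^ 2 = c ^ 2 * (M ^ 2 - a ^ 2) by ring,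
    Real.sqrt_mul (sq_nonneg c), Real.sqrt_sq hc.le,
    show (c * rPlus M a) ^ 2 + (c * a) ^ 2 = c * (c * (rPlus M a ^ 2 + a ^ 2)) by ring,
    mul_div_mul_left _ _ hc.ne', div_div, mul_comm c]

end Kerr

end Literature.Geometry.Lorentzian
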